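/-
Copyright (c) 2026. All rights reserved.
Released under Apache 2.0 license as described in the file LICENSE.
Authors: abc-iut cell, seat abc-iut-w5-d169 (gen 16; row «PL2-LEAF-2», optional leaf (Prim), part 2).
-/
import Literature.AnabelianGeometry.EtaleTheta.ZHatPrimaryIdempotents
import Literature.AnabelianGeometry.AbsoluteAnabelian.ZHatCompletionAdicCompleteness
import Literature.AnabelianGeometry.EtaleTheta.SettingModelConjugacyCompactness
import Literature.AnabelianGeometry.EtaleTheta.SettingModelFoxLevelTorus
import Literature.AnabelianGeometry.EtaleTheta.SettingModelFoxLevelBalanced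
import HarnessLib

/-!
# The primary decomposition `w ↦ (w^{e_ℓ})_ℓ` in `F̂₂`, and Theorem A (separation) from level-wise a-balance

Ribes–Zalesskii, *Profinite Groups* (2nd ed. 2010), Thm 2.7.1 / Thm 2.7.2 (`Ẑ = lim ℤ/nℤ ≅ ∏_ℓ ℤ_ℓ`; a procyclic
group is the product of its Sylow subgroups) [cite: RibesZalesskii2010, Thm 2.7.2]; Mochizuki, *The étale theta
function …* [EtTh] §1, PRIMS p. 12 («`Δ_X` … a profinite free group on 2 generators») [cite: MochizukiEtTh2009, §1 p.12]
— OUR model `F̂₂ = F₂hatT` (abc-iut-L2-t1) with the `Ẑ`-powers `powHat` (abc-iut-w5-d024, `SettingModelPowHat`), the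
`b`-axis `bAxis = b^Ẑ` / `bPow`, the level maps `FoxLevel.lev` (abc-iut-f-069, `SettingModelFoxLevelMaps/Torus`), the
compactness and (HR′) lemmas of `SettingModelConjugacyCompactness` (abc-iut-w5-d169 gen 15) and the primary
idempotents `ZHatLevel.primaryIdem ℓ = e_ℓ ∈ Ẑ` of `ZHatPrimaryIdempotents` (gen 16), all consumed BY NAME.

PROOF-ONLY file (no definition, no instance, no notation), abc-iut cell layer L6, seat abc-iut-w5-d169 (gen 16), row
PL2-LEAF-2 of abc-iut-L6-lead — optional leaf **(Prim)** of programme P-L2, rung (L2-T), part 2, and the tail of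
Theorem A of the desk text PL2-SEP-PROOF-v2 (sha16 9791feedc2eba23e) §4: *«Let `w = ∏_ℓ w_ℓ` be the primary
decomposition in the procyclic group `cl⟨w⟩` (`w_ℓ = w^{e_ℓ}`, pairwise commuting; `π_N(w_ℓ) = (π_N w)_ℓ`) … If all
`w_ℓ = 1` then `w = 1 ∈ C`. Otherwise pick `ℓ₀` with `w_{ℓ₀} ≠ 1` …; every `w_ℓ` commutes with `w_{ℓ₀}`, so
`w_ℓ ∈ C_F(w_{ℓ₀}) = g_{ℓ₀} B g_{ℓ₀}⁻¹` (Lemma 3′), a closed subgroup; hence `w = ∏ w_ℓ ∈ g_{ℓ₀} B g_{ℓ₀}⁻¹ ⊆ C.»*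

* `ZHatLevel.ker_level_mul_le`, ★ `ZHatLevel.eq_top_of_isClosed_of_forall_primaryIdem_mem` — a CLOSED subgroup of `Ẑ`
  containing every `e_ℓ` is `Ẑ` (finite step `exists_mem_level_eq_of_forall_primaryIdem_mem` + Cantor intersection
  `SettingModel.exists_eq_of_levelwise_mem` over the level kernels + density of `η(ℤ)`);
* the PRIMARY COMPONENTS `w^{e_ℓ} := powHat w (primaryIdem ℓ)` of `w ∈ F̂₂`: `powHat_mul_comm` (they commute),
  `apply_powHat_primaryIdem` / `…_mem_zpowers` / `…_pow_eq_one` (under any continuous `π : F̂₂ → Q`, `Q` killed by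
  `E`: `π(w^{e_ℓ}) = π(w)^{e_ℓ mod E} ∈ ⟨π w⟩` of `ℓ`-power order — «`π_N(w_ℓ) = (π_N w)_ℓ`») and the level forms
  `FoxLevel.lev_powHat_primaryIdem(_mem_zpowers)` / `FoxLevel.exists_lev_powHat_primaryIdem_pow_eq_one` — exactly
  the clause consumed by the orbit criterion (BAL) `FoxLevel.exists_forall_eq_conj_pow_of_normL_eq_zero`;
* ★ `mem_of_isClosed_of_forall_powHat_primaryIdem_mem` — `w` lies in every closed subgroup containing all `w^{e_ℓ}`
  (the profinite substitute for «`w = ∏ w_ℓ`»); `eq_one_of_forall_powHat_primaryIdem_eq_one`;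
* ★ **`exists_eq_conj_bPow_of_forall_primaryIdem`** — THEOREM A's LAST STEP: if every `w^{e_ℓ}` is conjugate to a
  `b`-power then so is `w` ((HR′) `exists_eq_conj_bPow_of_commute` + `isClosed_conj_bAxis`);
* ★★ **`exists_eq_conj_bPow_of_forall_level_balanced`** — THEOREM A (Sep) ITSELF in finite coefficients: `w ∈ F̂₂`
  a-balanced at EVERY level `(G, ZMod ℓ, A, B)` (`N_{π w}·α_w = 0`, every finite `G`, all `A B`, every prime `ℓ`) is
  `g b^t g⁻¹` — the assembly (BAL) `FoxLevel.exists_forall_eq_conj_pow_of_normL_eq_zero_zmod` (p545524) + (Cp)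
  `exists_eq_conj_bPow_of_forall_quotient` (p542668) + the present (Prim), all BY NAME.  What remains of Theorem B /
  ★ `ThetaEigenRigidityConj` is the torus-law input (T⇒E) producing the hypothesis, and (Hχ).
Classical profinite group theory at OUR semi-synthetic model; nothing of [EtTh] is asserted; no side is taken on
[IUTchIII] Cor. 3.12; typed ≠ proved ≠ print.
-/

noncomputable section

open CategoryTheory ProfiniteGrp ProfiniteGrp.ProfiniteCompletion

/-! ### The compactness step on `Ẑ`: closed subgroups containing the idempotents -/

namespace Literature.AnabelianGeometry.EtaleTheta

namespace ZHatLevel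

/-- The level kernels decrease along divisibility: `Ker(Ẑ → ℤ/nm) ≤ Ker(Ẑ → ℤ/n)`.
[cite: RibesZalesskii2010, Thm 2.7.1] -/
theorem ker_level_mul_le (n m : ℕ+) : (level (n * m)).ker ≤ (level n).ker := fun x hx => by
  rw [MonoidHom.mem_ker] at hx ⊢
  obtain ⟨z, rfl⟩ := (level_eq_one_iff_exists_pow (n * m) x).1 hx
  rw [PNat.mul_coe, pow_mul, map_pow, level_pow_self, one_pow]

/-- **A CLOSED subgroup of `Ẑ` containing every primary idempotent `e_ℓ` (`ℓ` prime) is all of `Ẑ`**: it meets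
every level class of `η(1)` (`exists_mem_level_eq_of_forall_primaryIdem_mem`), the level kernels are a directed
separating family of open subgroups of the compact group `Ẑ`, so it contains `η(1)` (Cantor intersection,
`SettingModel.exists_eq_of_levelwise_mem`), whose powers are dense. [cite: RibesZalesskii2010, Thm 2.7.2] -/
theorem eq_top_of_isClosed_of_forall_primaryIdem_mem (S : Subgroup (completion (GrpCat.of (Multiplicative ℤ))))
    (hS : IsClosed (S : Set (completion (GrpCat.of (Multiplicative ℤ)))))
    (h : ∀ ℓ : ℕ, ℓ.Prime → primaryIdem ℓ ∈ S) : S = ⊤ := by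
  -- `η(1) ∈ S` by compactness of `S`
  haveI : CompactSpace S := isCompact_iff_compactSpace.mp hS.isCompact
  have hdir : Directed (· ≥ ·) fun n : ℕ+ => (level n).ker := fun n m =>
    ⟨n * m, ker_level_mul_le n m, by rw [mul_comm]; exact ker_level_mul_le m n⟩
  have hsep : ∀ x : completion (GrpCat.of (Multiplicative ℤ)), (∀ n : ℕ+, x ∈ (level n).ker) → x = 1 :=
    fun x hx => ext_of_level fun n => by rw [map_one]; exact (MonoidHom.mem_ker).1 (hx n)
  obtain ⟨⟨s, hs⟩, hs1⟩ := SettingModel.exists_eq_of_levelwise_mem (P := S) (fun n : ℕ+ => (level n).ker)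
    isOpen_ker_level hdir hsep continuous_subtype_val (eta 1) fun n => by
      obtain ⟨s, hs, hsn⟩ := exists_mem_level_eq_of_forall_primaryIdem_mem S h n
      exact ⟨⟨s, hs⟩, by rw [MonoidHom.mem_ker, map_mul, map_inv, hsn, inv_mul_cancel]⟩
  have h1 : eta 1 ∈ S := by rw [hs1]; exact hs
  -- `⟨η(1)⟩` is dense and `S` is closed
  have hdense : Dense (S : Set (completion (GrpCat.of (Multiplicative ℤ)))) :=
    Literature.AnabelianGeometry.AbsoluteAnabelian.ZHatCompletion.dense_zpowers_eta_one.mono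
      ((Subgroup.zpowers_le (G := completion (GrpCat.of (Multiplicative ℤ)))).2 h1)
  rw [← Subgroup.coe_eq_univ, ← hS.closure_eq, hdense.closure_eq]

end ZHatLevel

/-! ### The primary components `w_ℓ = w^{e_ℓ}` of an element of `F̂₂` -/

namespace SettingModel

open ZHatLevel
open scoped Pointwise

/-- The primary components of `w` commute pairwise (they are values of the one-parameter group `powHat w` on the
commutative group `Ẑ`). [cite: MochizukiEtTh2009, §1 p.12] -/
theorem powHat_mul_comm (w : F₂hatT) (u v : ZH) : powHat w u * powHat w v = powHat w v * powHat w u := by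
  rw [← map_mul, ← map_mul, Literature.AnabelianGeometry.AbsoluteAnabelian.ZHatCompletion.mul_comm]

/-- **At every finite level the `e_ℓ`-component is a power of the image**: for a continuous `π : F̂₂ → Q` into a
group killed by `E`, `π(w^{e_ℓ}) = π(w)^{(e_ℓ mod E)}` (`apply_powHat_eq_pow`). [cite: MochizukiEtTh2009, §1 p.12] -/
theorem apply_powHat_primaryIdem {Q : Type*} [Group Q] [TopologicalSpace Q] (π : F₂hatT →ₜ* Q) (E : ℕ+)
    (hE : ∀ q : Q, q ^ (E : ℕ) = 1) (w : F₂hatT) (ℓ : ℕ) :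
    π (powHat w (primaryIdem ℓ)) = π w ^ (Multiplicative.toAdd (level E (primaryIdem ℓ))).val :=
  apply_powHat_eq_pow π E hE w _

/-- … hence lies in the cyclic subgroup generated by `π(w)`. [cite: MochizukiEtTh2009, §1 p.12] -/
theorem apply_powHat_primaryIdem_mem_zpowers {Q : Type*} [Group Q] [TopologicalSpace Q] (π : F₂hatT →ₜ* Q)
    (E : ℕ+) (hE : ∀ q : Q, q ^ (E : ℕ) = 1) (w : F₂hatT) (ℓ : ℕ) :
    π (powHat w (primaryIdem ℓ)) ∈ Subgroup.zpowers (π w) := by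
  rw [apply_powHat_primaryIdem π E hE]
  exact Subgroup.pow_mem _ (Subgroup.mem_zpowers _) _

/-- … and has `ℓ`-power order: `π(w^{e_ℓ})^{ℓ^{v_ℓ(E)}} = 1` (`ZHatLevel.pow_val_level_primaryIdem_pow_eq_one`).
[cite: MochizukiEtTh2009, §1 p.12] -/
theorem apply_powHat_primaryIdem_pow_eq_one {Q : Type*} [Group Q] [TopologicalSpace Q] (π : F₂hatT →ₜ* Q)
    (E : ℕ+) (hE : ∀ q : Q, q ^ (E : ℕ) = 1) (w : F₂hatT) (ℓ : ℕ) :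
    π (powHat w (primaryIdem ℓ)) ^ ℓ ^ (E : ℕ).factorization ℓ = 1 := by
  rw [apply_powHat_primaryIdem π E hE]
  exact pow_val_level_primaryIdem_pow_eq_one (hE (π w)) ℓ

namespace FoxLevel

variable {G : Type} [Group G] [Finite G]

/-- A finite group is killed by its cardinality, as a positive natural number. [folklore] -/
private theorem pow_cardPNat_eq_one (g : G) : g ^ ((⟨Nat.card G, Nat.card_pos⟩ : ℕ+) : ℕ) = 1 :=
  pow_card_eq_one'

/-- **Level form**: at the level `(G, A, B)`, `π(w^{e_ℓ}) = π(w)^{(e_ℓ mod |G|)}` (`FoxLevel.lev_powHat`).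
[cite: MochizukiEtTh2009, §1 p.12] -/
theorem lev_powHat_primaryIdem (A B : G) (w : F₂hatT) (ℓ : ℕ) :
    lev A B (powHat w (primaryIdem ℓ)) =
      lev A B w ^ (Multiplicative.toAdd (level ⟨Nat.card G, Nat.card_pos⟩ (primaryIdem ℓ))).val :=
  lev_powHat A B _ pow_cardPNat_eq_one w _

/-- **Level form**: `π(w^{e_ℓ}) ∈ ⟨π w⟩`. [cite: MochizukiEtTh2009, §1 p.12] -/
theorem lev_powHat_primaryIdem_mem_zpowers (A B : G) (w : F₂hatT) (ℓ : ℕ) :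
    lev A B (powHat w (primaryIdem ℓ)) ∈ Subgroup.zpowers (lev A B w) := by
  rw [lev_powHat_primaryIdem]
  exact Subgroup.pow_mem _ (Subgroup.mem_zpowers _) _

/-- **Level form**: `π(w^{e_ℓ})` has `ℓ`-power order — together with the previous theorem exactly the clause
`x ∈ zpowers (lev A B w) ∧ x ^ ℓ ^ j = 1` consumed by the orbit criterion
`FoxLevel.exists_forall_eq_conj_pow_of_normL_eq_zero` ((BAL), `SettingModelFoxLevelBalanced.lean`).
[cite: MochizukiEtTh2009, §1 p.12] -/
theorem exists_lev_powHat_primaryIdem_pow_eq_one (A B : G) (w : F₂hatT) (ℓ : ℕ) :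
    ∃ j : ℕ, lev A B (powHat w (primaryIdem ℓ)) ^ ℓ ^ j = 1 := by
  refine ⟨(Nat.card G).factorization ℓ, ?_⟩
  rw [lev_powHat_primaryIdem]
  exact pow_val_level_primaryIdem_pow_eq_one (pow_cardPNat_eq_one (lev A B w)) ℓ

end FoxLevel

/-- **`w` lies in every CLOSED subgroup containing all its primary components `w^{e_ℓ}`** (`ℓ` prime): the
preimage of such a subgroup under the continuous `powHat w : Ẑ → F̂₂` is a closed subgroup of `Ẑ` containing every
`e_ℓ`, hence all of `Ẑ` (`ZHatLevel.eq_top_of_isClosed_of_forall_primaryIdem_mem`), and `w = w^{ι(1)}`.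
This is the profinite substitute for «`w = ∏_ℓ w_ℓ`». [cite: MochizukiEtTh2009, §1 p.12] -/
theorem mem_of_isClosed_of_forall_powHat_primaryIdem_mem (w : F₂hatT) (K : Subgroup F₂hatT)
    (hK : IsClosed (K : Set F₂hatT)) (h : ∀ ℓ : ℕ, ℓ.Prime → powHat w (primaryIdem ℓ) ∈ K) : w ∈ K := by
  set S : Subgroup ZH := K.comap (powHat w).toMonoidHom with hSdef
  have hS : IsClosed (S : Set ZH) := hK.preimage (powHat w).continuous
  have htop : S = ⊤ := eq_top_of_isClosed_of_forall_primaryIdem_mem S hS fun ℓ hℓ => h ℓ hℓ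
  have h1 : iotaZ (Multiplicative.ofAdd 1) ∈ S := htop ▸ Subgroup.mem_top _
  rw [hSdef, Subgroup.mem_comap] at h1
  rw [← powHat_iotaZ_one w]
  exact h1

/-- **If every primary component of `w` is trivial then `w = 1`** (the case `K = 1`).
[cite: MochizukiEtTh2009, §1 p.12] -/
theorem eq_one_of_forall_powHat_primaryIdem_eq_one (w : F₂hatT)
    (h : ∀ ℓ : ℕ, ℓ.Prime → powHat w (primaryIdem ℓ) = 1) : w = 1 :=
  (Subgroup.mem_bot).1 (mem_of_isClosed_of_forall_powHat_primaryIdem_mem w ⊥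
    (by rw [Subgroup.coe_bot]; exact isClosed_singleton) fun ℓ hℓ => (Subgroup.mem_bot).2 (h ℓ hℓ))

/-- **Theorem A, final step (primary decomposition + (HR′) + compactness):** if EVERY primary component `w^{e_ℓ}`
(`ℓ` prime) of `w ∈ F̂₂` is conjugate to a `b`-power, then so is `w` itself.  Proof: if all components are trivial
`w = 1 = b^0`; otherwise some `w^{e_ℓ₀} = g b^{t₀} g⁻¹ ≠ 1`, every component commutes with it and so lies in the
closed subgroup `g b^Ẑ g⁻¹` (`exists_eq_conj_bPow_of_commute`, `isClosed_conj_bAxis`), which therefore contains `w`.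
[cite: MochizukiEtTh2009, §1 p.12] -/
theorem exists_eq_conj_bPow_of_forall_primaryIdem (w : F₂hatT)
    (h : ∀ ℓ : ℕ, ℓ.Prime → ∃ (g : F₂hatT) (t : ZH), powHat w (primaryIdem ℓ) = g * bPow t * g⁻¹) :
    ∃ (g : F₂hatT) (t : ZH), w = g * bPow t * g⁻¹ := by
  by_cases hall : ∀ ℓ : ℕ, ℓ.Prime → powHat w (primaryIdem ℓ) = 1
  · exact ⟨1, 1, by rw [eq_one_of_forall_powHat_primaryIdem_eq_one w hall, map_one, mul_one, inv_one,
      mul_one]⟩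
  push Not at hall
  obtain ⟨ℓ₀, hℓ₀, hne⟩ := hall
  obtain ⟨g, t₀, h₀⟩ := h ℓ₀ hℓ₀
  have ht₀ : bPow t₀ ≠ 1 := fun h1 => hne (by rw [h₀, h1, mul_one, mul_inv_cancel])
  -- every primary component lies in the closed subgroup `g b^Ẑ g⁻¹`
  have hmem : ∀ ℓ : ℕ, ℓ.Prime → powHat w (primaryIdem ℓ) ∈ (MulAut.conj g • bAxis : Subgroup F₂hatT) := by
    intro ℓ hℓ
    have hc : powHat w (primaryIdem ℓ) * (g * bPow t₀ * g⁻¹) = g * bPow t₀ * g⁻¹ * powHat w (primaryIdem ℓ) := by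
      rw [← h₀]; exact powHat_mul_comm w _ _
    obtain ⟨s, hs⟩ := exists_eq_conj_bPow_of_commute g ht₀ hc
    rw [hs, Subgroup.mem_smul_pointwise_iff_exists]
    exact ⟨bPow s, bPow_mem_bAxis s, by rw [MulAut.smul_def, MulAut.conj_apply]⟩
  have hw := mem_of_isClosed_of_forall_powHat_primaryIdem_mem w _ (isClosed_conj_bAxis g) hmem
  obtain ⟨y, hy, hwy⟩ := (Subgroup.mem_smul_pointwise_iff_exists _ _ _).1 hw
  obtain ⟨t, rfl⟩ := (mem_bAxis_iff _).1 hy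
  exact ⟨g, t, by rw [← hwy, MulAut.smul_def, MulAut.conj_apply]⟩

/-! ### Theorem A (separation): a-balanced at every level ⇒ conjugate to a `b`-power -/

/-- **THEOREM A of PL2-SEP-PROOF-v2 §4 (Sep), finite-coefficient form.**  If `w ∈ F̂₂` is a-BALANCED AT EVERY LEVEL —
for every finite group `G`, all `A B : G` and every prime `ℓ`, the level Fox chain of `w` at `(G, ZMod ℓ, A, B)`
satisfies `N_{π w} · α_w = 0` — then `w = g b^t g⁻¹` for some `g ∈ F̂₂`, `t ∈ Ẑ`.  Assembly of the leaves, all BY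
NAME: for each prime `ℓ` and each open normal `N`, the orbit criterion (BAL)
(`FoxLevel.exists_forall_eq_conj_pow_of_normL_eq_zero_zmod`, at the level `F̂₂/N` whose level map IS the quotient
map, `FoxLevel.lev_apply_eq_self`) conjugates the image of the primary component `w^{e_ℓ}` — an element of `⟨π w⟩`
of `ℓ`-power order (`FoxLevel.lev_powHat_primaryIdem_mem_zpowers`, `…_pow_eq_one`) — into `⟨π b⟩`; compactness
(Cp) (`exists_eq_conj_bPow_of_forall_quotient`) makes `w^{e_ℓ}` a conjugate of a `b`-power; and
`exists_eq_conj_bPow_of_forall_primaryIdem` concludes.  (The torus-law input (T⇒E) that PRODUCES the hypothesis is a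
separate leaf.) [cite: MochizukiEtTh2009, §1 p.12] -/
theorem exists_eq_conj_bPow_of_forall_level_balanced (w : F₂hatT)
    (h : ∀ (G : Type) [Group G] [Finite G] [DecidableEq G] (A B : G) (ℓ : ℕ) [Fact ℓ.Prime],
      Literature.GroupTheory.CombinatorialGroupTheory.FoxChain.normL (FoxLevel.lev A B w)
        (FoxLevel.alpha (k := ZMod ℓ) A B w) = 0) :
    ∃ (g : F₂hatT) (t : ZH), w = g * bPow t * g⁻¹ := by
  classical
  refine exists_eq_conj_bPow_of_forall_primaryIdem w fun ℓ hℓ => ?_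
  haveI := Fact.mk hℓ
  refine exists_eq_conj_bPow_of_forall_quotient _ fun N => ?_
  haveI : Finite (F₂hatT ⧸ (N : Subgroup F₂hatT)) := Subgroup.quotient_finite_of_isOpen _ N.isOpen
  -- the level `F̂₂/N`: its level map is the quotient map
  set A : F₂hatT ⧸ (N : Subgroup F₂hatT) := QuotientGroup.mk (eta (FreeGroup.of 0)) with hA
  set B : F₂hatT ⧸ (N : Subgroup F₂hatT) := QuotientGroup.mk (eta (FreeGroup.of 1)) with hB
  have hlev : FoxLevel.lev A B = QuotientGroup.mk' (N : Subgroup F₂hatT) :=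
    FoxLevel.lev_apply_eq_self (QuotientGroup.mk' (N : Subgroup F₂hatT))
      (by rw [QuotientGroup.ker_mk']; exact N.isOpen)
  obtain ⟨γ, hγ⟩ := FoxLevel.exists_forall_eq_conj_pow_of_normL_eq_zero_zmod (n := ℓ) A B w (h _ A B ℓ) hℓ
    (dvd_refl ℓ)
  obtain ⟨j, hj⟩ := FoxLevel.exists_lev_powHat_primaryIdem_pow_eq_one A B w ℓ
  obtain ⟨m, hm⟩ := hγ _ (FoxLevel.lev_powHat_primaryIdem_mem_zpowers A B w ℓ) j hj
  refine ⟨γ, m, ?_⟩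
  rw [hlev, QuotientGroup.mk'_apply] at hm
  exact hm

end SettingModel

end Literature.AnabelianGeometry.EtaleTheta

end
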